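import Literature.MathematicalPhysics.QuantumFieldTheory.Balaban1983to89.B9Cor35GDirKnitInputsAtOne
import Literature.MathematicalPhysics.QuantumFieldTheory.Balaban1983to89.B9Cor35GDirGStepCompressed
import Literature.MathematicalPhysics.QuantumFieldTheory.Balaban1983to89.B9Eq376ProjWordDirCompressedCongr
import Literature.MathematicalPhysics.QuantumFieldTheory.Balaban1983to89.B9Cor36GDirCutWindows
import Literature.MathematicalPhysics.QuantumFieldTheory.Balaban1983to89.B9Cor36CDirPDirAtField
import Literature.MathematicalPhysics.QuantumFieldTheory.Balaban1983to89.B9Cor35GDirKnitAvgPieceMajorant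
import Literature.MathematicalPhysics.QuantumFieldTheory.Balaban1983to89.B9Cor36GCubeAtLocCfg

/-!
v1.1 (dag-n06-d g35, LOCATED-37): + ★★★`gDir_knit_at_cutFieldU` — the α₀-UNIFORM edition (the auxiliary `α₀` of the knit legs quantified inside the universal block,
constants chosen before it; the original proof moved under it); `gDir_knit_at_cutField` is re-proved as its corollary, statement unchanged.

# `Balaban1983to89.B9Cor36GDirKnitAtCutField` — [Balaban1985BackgroundPropagators] COROLLARY 3.6 p. 408 ∕ THEOREM 3.4's `G`-CLAUSE FOR THE DIRICHLET BOND LETTER OF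
# RECORD `G_□(U) = GDirCKY i □ (DP_□D*) (bondsOverY Ω₀(□)) U` (the cube sequence's knit pair, p. 409 l. 1–5) AT THE SHARP-CUT SMALL FIELD `Ṽ = cutCfgS i T η A`, `T ⊇ Ω₀(□)`:
# `padΔ_{loc,□}(Ṽ)` IS A UNIT, the two (3.86) resolvent laws and the COMPRESSED one, the LEFT-ENTRY transfer, Theorem 3.3's three flat `U = 1` entries at the transfer rate and
# their transfers to `Ṽ` — EVERY slot of ✓`cor35_GDir_rows_of_piecesC` plugged: F1 (`U = 1` rows, CONDITIONAL BY NAME on `B6.Prop26DirichletPrinted`, socket `hKB`), F3 (windows),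
# ✓`hasMajorant_V0Y∕V1Y∕P0Y∕P1Y`, ✓`cdir_pdir_cube_at_field` + F2b (the projection word, field cut AT `Ω₀`), dag-n06-j ✓`hasMajorant_avgPieceCKnit` (the knit averaging piece)
# — seat dag-n06-c g34, FILE F4 of road (B5)'s rest (the bond twin of r05's ✓`cor36_G_cube_at_locCfg'`)

statement-level skeleton of published theorems with citation tags; proofs where landed; nothing here is a claim about the Yang–Mills mass gap

CITATION HEADER (lean-in-tree rule).  B9 = T. Bałaban, *Propagators for lattice gauge theories in a background field*, Commun. Math. Phys. **99** (1985)
389–434 [Balaban1985BackgroundPropagators] (held `paper:balaban1985-cmp99-background-propagators`; journal page = PDF page + 388): Cor. 3.6 p. 408 l. 1–14 («If a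
configuration U satisfies (3.35) … Applying the gauge transformation u we get U′ = Uᵘ = e^{iηA} … U′ satisfies (3.37) for the sequence {Ω′_j} with U = 1 and α₁ =
O(1)Mα₀. Assuming O(1)Mα₀ ≦ a₁ we can apply the above Corollary»); Cor. 3.5 p. 407 («with U = 1, these theorems were proved in [4]»); Thm 3.4 p. 400; (3.82)–(3.86)
p. 407; (3.69)–(3.77) pp. 404–406, (3.80)–(3.83) pp. 406–407 (the pieces of `V(A)`); Thm 3.3 p. 399, (3.42) p. 397; p. 409 l. 1–5 («G_□(U)»); p. 394; p. 410 l. 14–15.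
[4] = [Balaban1984PropagatorsII] Lemma 2.1 (2.61) p. 234, (2.51)–(2.55) p. 232, (2.66) p. 234, Prop. 2.6 (2.136) p. 247, p. 228, p. 248 l. 4–5.  Rows B9.Cor3.6 × B9.Cor3.5 ×
B9.Thm3.4 × B9.Thm3.3 (cells only; no row head changes).

WHY THIS FILE (cell `pub-ymgap`, node N06 [B9]; dag-n06-d g35's interface ✓`CubeRowsGDirCY` ∕ ✓`cubeRowsGDirCY_of_cutDatum` and LOCATED-35).  The heads' row `hRowsA`
asks, per `(x, U, □)`, for the four (3.42) rows of the letter of record at a small field `Ṽ` with `AgreeDirCY Ω₀(□) (Uᵘ) Ṽ`; for `Ṽ := cutCfgS i T η A` with `T` one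
layer beyond the reading set this agreement is ✓`agreeDirCY_gaugeY_cutCfgS`.  THIS FILE is the `G`-step at that field — the bond twin of r05's G-F7 ✓`cor36_G_cube_at_locCfg'`
with every slot re-keyed: the letter `GiK b i (TKnitCY i □ Ṽ) B = conj b(G_□(Ṽ)♯ℝ)` (F1), its `U = 1` face `(mDirC i □)♯` and the three `U = 1` rows CONDITIONAL BY NAME on
`B6.Prop26DirichletPrinted` (F1; socket `hKB`), the windows of the sharp cut (F3) feeding ✓`hasMajorant_V0Y∕V1Y` ((3.73)) and ✓`hasMajorant_P0Y∕P1Y` ((3.75)), the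
projection word ✓`cdir_pdir_cube_at_field` at the field cut AT `Ω₀(□)` moved to the compressed slot by F2b ✓`projK_projWordDir_projK_congr_of_inside` (the two fields
agree on the bonds inside `Ω₀(□) ⊆ T`), dag-n06-j's ✓`hasMajorant_avgPieceCKnit` at `a := Ã = A·𝟙[bond ⊂ T]` (F3 `ha_cut`), r05's (2.61) ✓`exists_h261_geoCK` and scale
transfers ✓`hST_geoCK`, and F2a ✓`cor35_GDir_of_piecesC` ∕ ✓`cor35_GDir_rows_of_piecesC`.  The common smallness is `α_T := alphaW(2CΛ²)·L² ≤ 60L²·2CΛ²`, met below an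
explicit threshold `a₁(d, L, M₂, b₀, b₁, ϱ′)`.

WHAT IS PROVED (0 `def`s … one bookkeeping lemma; 0 sorry; 0 new named facts; standard axioms): `kappaAvKnit_mono` (§1) and ★★★`gDir_knit_at_cutField` (§2): under
`h26 : B6.Prop26DirichletPrinted` (by name) and the x-free numerics of dag-n06-j's knit engine, there are `ρ > 0`, `θ ≥ 0`, thresholds `M₀, T₀, N₀`, `a₁ > 0` and Theorem
3.3's `A_G > 0` such that for every member above the thresholds, every cover cube `□`, every `Rr, H`, every real `K_B` inverting the compression of `mDirC i □` to `B`,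
every cut set `T ⊇ Ω₀(□)` and (3.35) datum `(A; Q ⊇ chart⁻¹T, C, ξ, Λ)` with the collar geometry of `Ω₀(□)`, p06's and dag-n06-j's window numerics at `α₁ := 2CΛ² ≤ a₁`,
`3α₁ ≤ ϱ′`, and a bi-contractive `Ṽ = cutCfgS i T η A`: `padΔ_{loc,□}[Q^knit](Ṽ)` IS A UNIT; the (3.86) laws; every LEFT entry `X·GiK(1) ≺ B₀P e^{−ρd}` transfers to
`X·GiK(Ṽ) ≺ B₀θP e^{−(1−9∕5000)ρd}`; the three flat `U = 1` entries at rate `ρ` and their transfers.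

HONEST SCOPE / NOT CLAIMED.  Assembly over landed modules — all BY NAME; nothing of [B9]'s analysis is asserted beyond what the inputs carry.  CONDITIONAL BY NAME (D-0044)
on `B6.Prop26DirichletPrinted` (hypothesis `h26`, NOT proved); DISPLAYED: the bond socket `hKB`, the datum and its numerics, the bi-contractivity `hU` (over `M_N(ℂ)` a
theorem for unitary data, F3 ✓`unitaryLike_cutCfgS_of_unitary`), member thresholds.  The COVARIANT entries (`∇_Ṽ`, `∇*_Ṽ`, `Δ_Ṽ` in place of the flat letters) are F5; the
member-level bundle `CubeRowsGDirCY` is F6.  Nothing on `d = 4`, the continuum, reflection positivity or the mass gap; NOT a node discharge; count-neutral; no row head changes.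
NEW file; nothing landed is modified.  `--supports stmt-QuantumFields-27239`.

RELATED IN THE TREE, NOT DUPLICATED (searched 2026-08-31: `rg 'gDir_knit_at_cutField|kappaAvKnit_mono'` over `Literature/` + `Summits/` = ∅): r05 ✓`B9Cor36GCubeAtLocCfg`
(whole-torus letter, smooth cut-off — the pattern, transcribed), this seat's ✓`B9Cor36GpDirExtAtField` (the SITE Dirichlet letter at the sharp cut), F1–F3, F2a∕b (USED).
-/

noncomputable section

namespace Literature.MathematicalPhysics.QuantumFieldTheory.Balaban1983to89.B9Cor36GDirKnitAtCutField

open NormedSpace Complex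
open B6RandomWalk (HasMajorant hasMajorant_mono hasMajorant_add Ineq261 c1_nonneg)
open B9Thm34Ext (toB6)
open B9Eq352DivFormLetters (conj)
open B9Eq39Adjoint (fluct covD)
open B6KLevelCensusIndexV1 (KIdx kGeo)
open B6Cover236MultiLevelBlocks (cubes)
open B6GlobalChartV1 (PV boxEquiv)
open B9BackgroundsKLevelV1 (shiftsV1)
open B9Eq360DeltaPrimeAY (AfldY)
open B9Eq337CutFieldDirY (cutFldS cutCfgS UboxY_cutCfgS)
open B9CubeLettersOpsL0 (cubeFamY levCubeY)
open B9CubeLettersBondOpsL0 (BlkCubeY)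
open B9CubeGeometryInputs (geoCK geoCK_len_pos geoCK_eta geoCK_eta_pos geoCK_dist_axioms RM1 N1 exists_h261_geoCK hST_geoCK geoCK_site_nonempty)
open B9Cor35GCubeInputsAtOne (blkBK DK LapK)
open B9Cor35GAtCubeLetters (kappa385d kappa385d_nonneg lapPieceK)
open B9Cor35GDirInputsAtOne (GiK GdK mDirC geoDirBI domDirBI admDirBI GDirBFam)
open B9Cor35GDirGStep (VdK projK)
open B9Cor35GDirAtCubeLetters (projPieceDirK)
open B9Cor35GDirAtKnitCubeLetters (avgPieceCKnit dirB_split_CK)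
open B9Cor35GDirKnitInputsAtOne (TKnitCY TKnitCY_apply dirPadY_TKnitCY TKnitCY_one_eq_liftOpY_mDirC thm33_GiK_knit_of_prop26Dirichlet)
open B9Cor35GDirGStepCompressed (hasMajorant_projK_mul_mul_projK cor35_GDir_of_piecesC cor35_GDir_rows_of_piecesC)
open B9Eq376ProjPieceDirDictY (projPieceDirK_eq_firstOrder_add_projWord)
open B9Eq376ProjWordDirCompressedCongr (projK_projWordDir_projK_congr_of_inside splitC_of_split_of_congr)
open B9Eq371CoCurlLeibnizY (V0Y V1Y conj_hessY_one_sub_hessY_eq)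
open B9Ineq373HessianPieceBoundsY (dSite cV0 cV1 hasMajorant_V0Y hasMajorant_V1Y)
open B9Eq375GradDivSplitY (P0Y P1Y)
open B9Ineq375GradDivBoundsY (cP0 cP1 hasMajorant_P0Y hasMajorant_P1Y)
open B9Cor36GCubeWindows (alphaW alphaW_nonneg)
open B9Cor36GCubeAtLocCfg (self_le_alphaW alphaW_le_sixty_mul kernel_const_mono)
open B9Cor35CinvAtCubeLetters (kernel_rate_mono)
open B9Cor36GDirCutWindows (hW1_cut hW2_cut hW3_cut ha_cut)
open B9Cor36CDirPDirAtField (cdir_pdir_cube_at_field)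
open B9Cor35GDirKnitAvgPieceMajorant (kappaAvKnit kappaAvKnit_nonneg hasMajorant_avgPieceCKnit)
open B9Cor35GpDirInputsAtOne (dirDomY)
open B9DirichletBondCubePairY (padDeltaLocCY)
open B9Eq3115KnitCubeLetterY (QknitCubeY QsknitCubeY)
open B9C2FormBoxRegimeY (Kpl)
open B7Prop5CplxLevels (epsCplx tauCplx)
open B7Prop2Explicit (C0 c2')
open B7Prop3Flat (c3)
open Node00 (SiteY FBondY CfgY toKT shiftY UboxY liftOpY gradY divY)
open Node00.OpsYLocalInverse (dirPadY)
open Node00.OpsYCubeProjectionG (PDirCubeY DPDsDirCubeY)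
open Node00.OpsYCubeDirInverseBond (indProjY bondsOverY)
open scoped Matrix Matrix.Norms.L2Operator

variable {d ℓ : ℕ} {hd : 1 ≤ d + 1} {hL : Odd (ℓ + 1) ∧ 1 < ℓ + 1} {b₀ b₁ : ℝ}

/-! ## §1  Bookkeeping: the knit averaging constant is monotone in `α₁` -/

section Book

/-- `κ^knit_av(α₁) ≤ κ^knit_av(α₁′)` for `0 ≤ α₁ ≤ α₁′` (`b₁ ≥ 0`, `ϱ′ > 0`). [cite: Balaban1985BackgroundPropagators, (3.83) p.407, bookkeeping] -/
theorem kappaAvKnit_mono {N : ℕ} {b₁' ϱ' α₁ α₁' δ : ℝ} (hb : 0 ≤ b₁') (hϱ' : 0 < ϱ') (hα : α₁ ≤ α₁') :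
    kappaAvKnit d ℓ N b₁' ϱ' α₁ δ ≤ kappaAvKnit d ℓ N b₁' ϱ' α₁' δ := by
  unfold kappaAvKnit
  have h0 : 0 ≤ 4 * ((d : ℝ) + 1) * (9 / (2 * ϱ')) * b₁' * (((ℓ + 1 : ℕ) : ℝ) ^ (d + 1)) := by positivity
  have h1 : (N : ℝ) ^ 4 + 1 + 2 * ((d : ℝ) + 1) * (N : ℝ) ^ 4 * (9 / (2 * ϱ') * α₁) ≤
      (N : ℝ) ^ 4 + 1 + 2 * ((d : ℝ) + 1) * (N : ℝ) ^ 4 * (9 / (2 * ϱ') * α₁') := by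
    have : 0 ≤ 2 * ((d : ℝ) + 1) * (N : ℝ) ^ 4 * (9 / (2 * ϱ')) := by positivity
    nlinarith
  exact mul_le_mul_of_nonneg_right (mul_le_mul_of_nonneg_left h1 h0) (Real.exp_pos _).le

end Book

/-! ## §2  ★★★ Corollary 3.6 for the Dirichlet bond letter of record at the sharp-cut field: every slot of `cor35_GDir_rows_of_piecesC` plugged -/

section Main

variable {N : ℕ} [Nonempty (Fin N)]
variable {ι : Type} [Fintype ι] [DecidableEq ι] (b : Module.Basis ι ℝ (Matrix (Fin N) (Fin N) ℂ))

set_option maxHeartbeats 4000000 in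
/-- ★★★ **THE α₀-UNIFORM EDITION OF `gDir_knit_at_cutField`** (dag-n06-d g35, LOCATED-37): the SAME Cor. 3.6 ∕ Thm 3.4 `G`-clause for the Dirichlet bond letter of
record at the sharp-cut field, with the auxiliary regime parameter `α₀` (used only for the knit averaging legs through dag-n06-j's ✓`hasMajorant_avgPieceCKnit`:
`0 < α₀`, `0 ≤ Mα₀`, `K_pl(Mα₀)L⁴ < α₀′`) quantified INSIDE the universal block, so that the constants `(ρ, θ, M₀, T₀, N₀, a₁, A_G)` are chosen BEFORE `α₀` and are
uniform in it — as print has them («constants depending on d and L only»); the member-wide heads offer a member-dependent `α₀` (`c·M·α₀ ≤ a₁`, `M = L·M_h` unbounded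
over the record), so only this ordering yields x-free named constants.  The proof is the original one, verbatim, with `α₀ hα₀` introduced after the witnesses;
`gDir_knit_at_cutField` below is now its corollary.
[cite: Balaban1985BackgroundPropagators, Cor. 3.6 p.408, Cor. 3.5 p.407, Thm 3.4 p.400, (3.82)–(3.86) p.407, (3.69)–(3.77) pp.404–406, (3.83) p.407, Thm 3.3 p.399, (3.42) p.397, p.409 l.1–5; Balaban1984PropagatorsII, Lemma 2.1 (2.61) p.234, (2.51) p.232, (2.66) p.234, Prop. 2.6 (2.136) p.247, p.248 l.4–5] -/
theorem gDir_knit_at_cutFieldU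
    (h26 : B6.Prop26DirichletPrinted (geoDirBI (d := d) (ℓ := ℓ) (hd := hd) (hL := hL) (b₀ := b₀) (b₁ := b₁)) domDirBI admDirBI GDirBFam)
    (hℓ : 1 ≤ ℓ) (hb₀ : 0 < b₀) (hb₁ : b₀ ≤ b₁) (M₂ : ℝ) (hM₂ : 0 ≤ M₂) (hrepr : ∀ (v : Matrix (Fin N) (Fin N) ℂ) (j : ι), |b.repr v j| ≤ M₂ * ‖v‖)
    -- the x-free numerics of dag-n06-j's knit engine (head rows)
    {α₀' ϱ' ϱ : ℝ} (hα' : 0 < α₀') (hα3 : C0 (d + 1) * α₀' ≤ 1 / 3) (hα8 : 8 * α₀' ≤ c2' (d + 1) (ℓ + 1))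
    (hϱ' : 0 < ϱ') (hϱ : 0 < ϱ)
    (hsmall' : Real.exp (4 * (800 * (((d + 1 : ℕ) : ℝ) + 1) ^ 2 * (((d + 1 : ℕ) : ℝ) + 4)) * α₀') * (1 + 8 * (131072 * (((d + 1 : ℕ) : ℝ) + 1) ^ 2) * ϱ') ≤ 2)
    (hc₃' : 2 * ϱ' ≤ c3 (d + 1) (ℓ + 1)) (hϱ'1 : 409600 * (((d + 1 : ℕ) : ℝ) + 1) ^ 2 * ϱ' ≤ 1)
    (hE : epsCplx (d + 1) (ℓ + 1) ϱ' 0 ≤ 1 / 16)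
    (hdX : ((d + 1 : ℕ) : ℝ) * (epsCplx (d + 1) (ℓ + 1) ϱ' 0 + tauCplx (d + 1) (ℓ + 1) α₀' 0 ϱ' 0) ≤ 1 / 16)
    (hsmallJ : Real.exp (4480 * (((d + 1 : ℕ) : ℝ) + 1) ^ 2 * (((d + 1 : ℕ) : ℝ) + 4) * α₀' + 240000 * (((d + 1 : ℕ) : ℝ) + 1) ^ 3 * ϱ') *
      (1 + 8 * (2097152 * (((d + 1 : ℕ) : ℝ) + 1) ^ 2) * ϱ) ≤ 2)
    (hc₃J : 2 * ϱ ≤ c3 (d + 1) (ℓ + 1) / 4) :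
    ∃ ρ θ M₀ T₀ : ℝ, ∃ N₀ : ℕ, 0 < ρ ∧ 0 ≤ θ ∧ ∃ a₁ : ℝ, 0 < a₁ ∧ ∃ AG : ℝ, 0 < AG ∧
    ∀ (i : KIdx d ℓ hd hL b₀ b₁) (c : ↥(cubes (toKT i).D.toDomains)) (Rr : ℝ) (H : Prop),
      M₀ ≤ ((ℓ : ℝ) + 1) * (toKT i).Mh → N₀ + 1 ≤ (toKT i).R * ((ℓ + 1) * (toKT i).Mh) → T₀ ≤ RM1 i →
    ∀ α₀ : ℝ, 0 < α₀ → 0 ≤ (kGeo i).M * α₀ → Kpl i ((kGeo i).M * α₀) * (kGeo i).L ^ 4 < α₀' →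
    ∀ (KB : Matrix (FBondY i) (FBondY i) ℝ),
      (mDirC i c).submatrix (fun v : ↥(bondsOverY i (dirDomY i c)) => (v : FBondY i)) (fun v : ↥(bondsOverY i (dirDomY i c)) => (v : FBondY i)) *
        KB.submatrix (fun v : ↥(bondsOverY i (dirDomY i c)) => (v : FBondY i)) (fun v : ↥(bondsOverY i (dirDomY i c)) => (v : FBondY i)) = 1 →
    ∀ (T : Finset (SiteY i)) (A : AfldY (Matrix (Fin N) (Fin N) ℂ) i) (Q : Set (Site (PV d ℓ i.m i.K hd hL) 0)) (C ξ Λ : ℝ),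
      0 ≤ C → (kGeo i).eta ≤ ξ → 1 ≤ Λ → LatticeNorms.scaleLen ((ℓ : ℝ) + 1) (kGeo i).eta (c.1.1 + 1) ≤ Λ * ξ →
      (∀ z ∈ dirDomY i c, z ∈ T) → (∀ z ∈ T, (boxEquiv i.hN).symm z ∈ Q) →
      (∀ κ, ∀ x ∈ Q, ‖A κ x‖ ≤ C * ξ⁻¹) →
      (∀ μ ν, ∀ x ∈ Q, ‖(((kGeo i).eta : ℂ)⁻¹) • covD (shiftsV1 (PV d ℓ i.m i.K hd hL)) (fun _ _ => (1 : (Matrix (Fin N) (Fin N) ℂ)ˣ)) μ (A ν) x‖ ≤ C * (ξ ^ 2)⁻¹) →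
      (∀ z : SiteY i, 1 ≤ levCubeY i c z → z ∈ dirDomY i c ∧ ∀ μ, shiftY i μ z ∈ dirDomY i c ∧ (shiftY i μ).symm z ∈ dirDomY i c ∧
        ∀ ν, shiftY i ν (shiftY i μ z) ∈ dirDomY i c ∧ shiftY i ν ((shiftY i μ).symm z) ∈ dirDomY i c ∧ (shiftY i ν).symm ((shiftY i μ).symm z) ∈ dirDomY i c) →
      2 * C * Λ ^ 2 ≤ a₁ → 3 * (2 * C * Λ ^ 2) ≤ ϱ' →
      4 * α₀' ≤ c2' (d + 1) (ℓ + 1) →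
      Real.exp (4 * (800 * (((d + 1 : ℕ) : ℝ) + 1) ^ 2 * (((d + 1 : ℕ) : ℝ) + 4)) * α₀') * (1 + 8 * (131072 * (((d + 1 : ℕ) : ℝ) + 1) ^ 2) * (2 * C * Λ ^ 2)) ≤ 2 →
      2 * (2 * C * Λ ^ 2) ≤ c3 (d + 1) (ℓ + 1) → 4096 * ((d + 1 : ℕ) : ℝ) * (2 * C * Λ ^ 2) ≤ 1 →
      (∀ μ x, ‖(cutCfgS i T (kGeo i).eta A μ x : Matrix (Fin N) (Fin N) ℂ)‖ ≤ 1 ∧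
        ‖(((cutCfgS i T (kGeo i).eta A μ x)⁻¹ : (Matrix (Fin N) (Fin N) ℂ)ˣ) : Matrix (Fin N) (Fin N) ℂ)‖ ≤ 1) →
      IsUnit (padDeltaLocCY i c (QknitCubeY i c) (QsknitCubeY i c) (DPDsDirCubeY i c (dirDomY i c)) (bondsOverY i (dirDomY i c)) (cutCfgS i T (kGeo i).eta A)) ∧
      (GdK b i (TKnitCY i c (cutCfgS i T (kGeo i).eta A)) (bondsOverY i (dirDomY i c)) =
          GdK b i (TKnitCY i c (fun _ _ => 1)) (bondsOverY i (dirDomY i c)) +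
            GdK b i (TKnitCY i c (fun _ _ => 1)) (bondsOverY i (dirDomY i c)) * VdK b i (TKnitCY i c) (bondsOverY i (dirDomY i c)) (cutCfgS i T (kGeo i).eta A) *
              GdK b i (TKnitCY i c (cutCfgS i T (kGeo i).eta A)) (bondsOverY i (dirDomY i c)) ∧
        GdK b i (TKnitCY i c (cutCfgS i T (kGeo i).eta A)) (bondsOverY i (dirDomY i c)) =
          GdK b i (TKnitCY i c (fun _ _ => 1)) (bondsOverY i (dirDomY i c)) +
            GdK b i (TKnitCY i c (cutCfgS i T (kGeo i).eta A)) (bondsOverY i (dirDomY i c)) *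
              (VdK b i (TKnitCY i c) (bondsOverY i (dirDomY i c)) (cutCfgS i T (kGeo i).eta A) * GdK b i (TKnitCY i c (fun _ _ => 1)) (bondsOverY i (dirDomY i c))) ∧
        GiK b i (TKnitCY i c (cutCfgS i T (kGeo i).eta A)) (bondsOverY i (dirDomY i c)) =
          GiK b i (TKnitCY i c (fun _ _ => 1)) (bondsOverY i (dirDomY i c)) +
            GiK b i (TKnitCY i c (cutCfgS i T (kGeo i).eta A)) (bondsOverY i (dirDomY i c)) *
              (VdK b i (TKnitCY i c) (bondsOverY i (dirDomY i c)) (cutCfgS i T (kGeo i).eta A) * GiK b i (TKnitCY i c (fun _ _ => 1)) (bondsOverY i (dirDomY i c)))) ∧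
      (∀ (X : Module.End ℝ (FBondY i × ι → ℝ)) (B₀' : ℝ) (P : BlkCubeY i c → ℝ), 0 ≤ B₀' → (∀ y, 0 ≤ P y) →
        HasMajorant (g := toB6 (geoCK i c) Rr H) (blkBK i c) (X * GiK b i (TKnitCY i c (fun _ _ => 1)) (bondsOverY i (dirDomY i c)))
          (fun a a' => B₀' * P a * Real.exp (-(ρ * (geoCK i c).dist a a'))) →
        HasMajorant (g := toB6 (geoCK i c) Rr H) (blkBK i c) (X * GiK b i (TKnitCY i c (cutCfgS i T (kGeo i).eta A)) (bondsOverY i (dirDomY i c)))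
          (fun a a' => B₀' * θ * P a * Real.exp (-((1 - 9 / 5000) * ρ * (geoCK i c).dist a a')))) ∧
      (HasMajorant (g := toB6 (geoCK i c) Rr H) (blkBK i c) (GiK b i (TKnitCY i c (fun _ _ => 1)) (bondsOverY i (dirDomY i c)))
          (fun a a' => AG * (geoCK i c).len a ^ 2 * Real.exp (-(ρ * (geoCK i c).dist a a'))) ∧
        (∀ ν : Fin (d + 1), HasMajorant (g := toB6 (geoCK i c) Rr H) (blkBK i c) (DK b i ν * GiK b i (TKnitCY i c (fun _ _ => 1)) (bondsOverY i (dirDomY i c)))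
          (fun a a' => AG * (geoCK i c).len a * Real.exp (-(ρ * (geoCK i c).dist a a')))) ∧
        HasMajorant (g := toB6 (geoCK i c) Rr H) (blkBK i c) (LapK b i * GiK b i (TKnitCY i c (fun _ _ => 1)) (bondsOverY i (dirDomY i c)))
          (fun a a' => AG * Real.exp (-(ρ * (geoCK i c).dist a a')))) ∧
      (HasMajorant (g := toB6 (geoCK i c) Rr H) (blkBK i c) (GiK b i (TKnitCY i c (cutCfgS i T (kGeo i).eta A)) (bondsOverY i (dirDomY i c)))
          (fun a a' => AG * θ * (geoCK i c).len a ^ 2 * Real.exp (-((1 - 9 / 5000) * ρ * (geoCK i c).dist a a'))) ∧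
        (∀ ν : Fin (d + 1), HasMajorant (g := toB6 (geoCK i c) Rr H) (blkBK i c) (DK b i ν * GiK b i (TKnitCY i c (cutCfgS i T (kGeo i).eta A)) (bondsOverY i (dirDomY i c)))
          (fun a a' => AG * θ * (geoCK i c).len a * Real.exp (-((1 - 9 / 5000) * ρ * (geoCK i c).dist a a')))) ∧
        HasMajorant (g := toB6 (geoCK i c) Rr H) (blkBK i c) (LapK b i * GiK b i (TKnitCY i c (cutCfgS i T (kGeo i).eta A)) (bondsOverY i (dirDomY i c)))
          (fun a a' => AG * θ * 1 * Real.exp (-((1 - 9 / 5000) * ρ * (geoCK i c).dist a a')))) := by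
  classical
  have hSb : 0 ≤ ∑ j, ‖b j‖ := Finset.sum_nonneg fun j _ => norm_nonneg _
  have hMS : 0 ≤ M₂ * ∑ j, ‖b j‖ := mul_nonneg hM₂ hSb
  have hL1 : (1 : ℝ) ≤ (ℓ : ℝ) + 1 := by linarith [(Nat.cast_nonneg ℓ : (0 : ℝ) ≤ ℓ)]
  have hb₁0 : 0 ≤ b₁ := hb₀.le.trans hb₁
  -- F1: Theorem 3.3 at `U = 1` for the letter of record, conditional by name (rate `δ₃`, constant `AG`, threshold `M₁`)
  obtain ⟨M₁, δ₃, AG, hM₁, hδ₃, hAG, h33⟩ := thm33_GiK_knit_of_prop26Dirichlet (N := N) b h26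
  -- ROAD (I): the Dirichlet `C_□ ∕ 𝒫_□` package at the field cut AT `Ω₀(□)` (its (3.77) half is the `PP`-slot)
  obtain ⟨δC, δP, BC, K, MP, TP, NP, hδC, hδP, hBC, hK, aP, haP, HCP⟩ := cdir_pdir_cube_at_field b d ℓ hℓ M₂ hM₂ hrepr
  -- one rate below both
  set δ : ℝ := min δ₃ δP with hδdef
  have hδ : 0 < δ := lt_min hδ₃ hδP
  have hδG' : δ ≤ δ₃ := min_le_left _ _
  have hδP' : δ ≤ δP := min_le_right _ _
  set δ₀ : ℝ := δ / 2 with hδ₀def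
  have hδ₀ : 0 < δ₀ := half_pos hδ
  -- (2.61) at the rate `δ₀ = ρ`, exponent `9∕5000`
  obtain ⟨dB, h261⟩ := exists_h261_geoCK d ℓ hδ₀
  have hc1 : 0 ≤ B6.c1 dB δ₀ (9 / 5000) := c1_nonneg _ _ _
  -- the constants
  set cV : ℝ := (M₂ * ∑ j, ‖b j‖) * max (cV0 d) (cV1 d) * Real.exp (2 * δ) with hcVdef
  set cP : ℝ := (M₂ * ∑ j, ‖b j‖) * max (cP0 d) (cP1 d) * Real.exp (2 * δ) with hcPdef
  set κ₂ : ℝ := (M₂ * ∑ j, ‖b j‖) * kappaAvKnit d ℓ N b₁ ϱ' 1 δ with hκ₂def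
  have hcV00 : 0 ≤ cV0 d := by unfold cV0; positivity
  have hcP00 : 0 ≤ cP0 d := by unfold cP0; positivity
  have hcV : 0 ≤ cV := by rw [hcVdef]; exact mul_nonneg (mul_nonneg hMS (le_max_of_le_left hcV00)) (Real.exp_pos _).le
  have hcP : 0 ≤ cP := by rw [hcPdef]; exact mul_nonneg (mul_nonneg hMS (le_max_of_le_left hcP00)) (Real.exp_pos _).le
  have hκ₂ : 0 ≤ κ₂ := by rw [hκ₂def]; exact mul_nonneg hMS (kappaAvKnit_nonneg hb₁0 hϱ' zero_le_one)
  set κs : ℝ := kappa385d AG (cV + cP) K κ₂ (((ℓ : ℝ) + 1) ^ 4) (B6.c1 dB δ₀ (9 / 5000)) (d + 1) * B6.c1 dB δ₀ (9 / 5000) with hκsdef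
  have hκs : 0 ≤ κs := by
    rw [hκsdef]; exact mul_nonneg (kappa385d_nonneg hAG.le (add_nonneg hcV hcP) hK hκ₂ (by positivity) hc1) hc1
  -- the size threshold on `α₁ = 2CΛ²`
  set a₁ : ℝ := min aP (min (1 / 6) (1 / (120 * ((ℓ : ℝ) + 1) ^ 2 * (κs + 1)))) with ha₁def
  have ha₁ : 0 < a₁ := lt_min haP (lt_min (by norm_num) (by positivity))
  refine ⟨δ₀, 2 * B6.c1 dB δ₀ (9 / 5000), max MP M₁, max TP (max (4 * Real.log ((ℓ : ℝ) + 1) / (9 / 5000 * δ₀)) 3), max NP (N1 d ℓ (9 / 5000 * δ₀)), hδ₀,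
    by positivity, a₁, ha₁, AG, hAG, ?_⟩
  intro i c Rr H hM hN hT α₀ hα₀ hMα hKpl KB hKB T A Q C ξ Λ hC hξ hΛ hΛξ hTS hQT hA hdA hS2 hα₁a hα₁ϱ hα4' hsmall hc₃ hsm hU
  -- thresholds
  have hMP : MP ≤ ((ℓ : ℝ) + 1) * (toKT i).Mh := (le_max_left _ _).trans hM
  have hMG' : M₁ ≤ ((ℓ : ℝ) + 1) * i.Mh := (le_max_right _ _).trans hM
  have hNP : NP + 1 ≤ (toKT i).R * ((ℓ + 1) * (toKT i).Mh) := le_trans (Nat.succ_le_succ (le_max_left _ _)) hN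
  have hN1 : N1 d ℓ (9 / 5000 * δ₀) + 1 ≤ (toKT i).R * ((ℓ + 1) * (toKT i).Mh) := le_trans (Nat.succ_le_succ (le_max_right _ _)) hN
  have hTP : TP ≤ RM1 i := (le_max_left _ _).trans hT
  have hT1 : 4 * Real.log ((ℓ : ℝ) + 1) / (9 / 5000 * δ₀) ≤ RM1 i := ((le_max_left _ _).trans (le_max_right _ _)).trans hT
  have hRM : 2 < RM1 i := lt_of_lt_of_le (by norm_num) (((le_max_right _ _).trans (le_max_right _ _)).trans hT)
  -- the size `α₁ = 2CΛ²` and the window size `α_T = alphaW(α₁)·L²`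
  set α₁ : ℝ := 2 * C * Λ ^ 2 with hα₁def
  have hα₁0 : 0 ≤ α₁ := by rw [hα₁def]; positivity
  have hα₁P : α₁ ≤ aP := hα₁a.trans (min_le_left _ _)
  have hα₁6 : α₁ ≤ 1 / 6 := hα₁a.trans ((min_le_right _ _).trans (min_le_left _ _))
  have hα₁κ : α₁ ≤ 1 / (120 * ((ℓ : ℝ) + 1) ^ 2 * (κs + 1)) := hα₁a.trans ((min_le_right _ _).trans (min_le_right _ _))
  have hα₁1 : α₁ ≤ 1 := hα₁6.trans (by norm_num)
  set αW : ℝ := alphaW α₁ * ((ℓ : ℝ) + 1) ^ 2 with hαWdef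
  have hαW0 : 0 ≤ αW := by rw [hαWdef]; exact mul_nonneg (alphaW_nonneg hα₁0) (sq_nonneg _)
  have hL2 : (1 : ℝ) ≤ ((ℓ : ℝ) + 1) ^ 2 := one_le_pow₀ hL1
  have hαWα : α₁ ≤ αW := by
    rw [hαWdef]
    calc α₁ ≤ alphaW α₁ := self_le_alphaW hα₁0
      _ = alphaW α₁ * 1 := (mul_one _).symm
      _ ≤ alphaW α₁ * ((ℓ : ℝ) + 1) ^ 2 := mul_le_mul_of_nonneg_left hL2 (alphaW_nonneg hα₁0)
  have hκs1 : 0 < κs + 1 := by linarith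
  have hαWκ : αW * (κs + 1) ≤ 1 / 2 := by
    have h60 : αW ≤ 60 * ((ℓ : ℝ) + 1) ^ 2 * α₁ := by
      rw [hαWdef]; have h := alphaW_le_sixty_mul hα₁0 hα₁6; nlinarith [sq_nonneg ((ℓ : ℝ) + 1)]
    have hL20 : 0 < ((ℓ : ℝ) + 1) ^ 2 := by positivity
    calc αW * (κs + 1) ≤ 60 * ((ℓ : ℝ) + 1) ^ 2 * α₁ * (κs + 1) := mul_le_mul_of_nonneg_right h60 hκs1.le
      _ ≤ 60 * ((ℓ : ℝ) + 1) ^ 2 * (1 / (120 * ((ℓ : ℝ) + 1) ^ 2 * (κs + 1))) * (κs + 1) := by gcongr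
      _ = 1 / 2 := by field_simp; ring
  have hαW1 : αW ≤ 1 := by nlinarith
  have hsmallκ : kappa385d AG (cV + cP) K κ₂ (((ℓ : ℝ) + 1) ^ 4) (B6.c1 dB δ₀ (9 / 5000)) (d + 1) * αW * B6.c1 dB δ₀ (9 / 5000) < 1 := by
    have : kappa385d AG (cV + cP) K κ₂ (((ℓ : ℝ) + 1) ^ 4) (B6.c1 dB δ₀ (9 / 5000)) (d + 1) * αW * B6.c1 dB δ₀ (9 / 5000) = κs * αW := by
      rw [hκsdef]; ring
    rw [this]; nlinarith
  have hinv2 : (1 - kappa385d AG (cV + cP) K κ₂ (((ℓ : ℝ) + 1) ^ 4) (B6.c1 dB δ₀ (9 / 5000)) (d + 1) * αW * B6.c1 dB δ₀ (9 / 5000))⁻¹ ≤ 2 := by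
    have e : kappa385d AG (cV + cP) K κ₂ (((ℓ : ℝ) + 1) ^ 4) (B6.c1 dB δ₀ (9 / 5000)) (d + 1) * αW * B6.c1 dB δ₀ (9 / 5000) = κs * αW := by
      rw [hκsdef]; ring
    rw [e]
    have h12 : 1 / 2 ≤ 1 - κs * αW := by nlinarith
    calc (1 - κs * αW)⁻¹ ≤ (1 / 2)⁻¹ := inv_anti₀ (by norm_num) h12
      _ = 2 := by norm_num
  -- geometry
  haveI : Nonempty (geoCK i c).Site := geoCK_site_nonempty i c
  obtain ⟨hdnn, -, -, -⟩ := geoCK_dist_axioms i c Rr H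
  set η : ℝ := (kGeo i).eta with hηdef
  have hη : 0 < η := by rw [hηdef, ← geoCK_eta i c]; exact geoCK_eta_pos i c
  set S := dirDomY i c with hSdef
  set B := bondsOverY i (dirDomY i c) with hBdef
  set V := cutCfgS i T η A with hVdef
  have hS1 : ∀ z : SiteY i, 1 ≤ levCubeY i c z → z ∈ S := fun z hz => (hS2 z hz).1
  have hQS : ∀ z ∈ S, (boxEquiv i.hN).symm z ∈ Q := fun z hz => hQT z (hTS z hz)
  have hS2T : ∀ z : SiteY i, 1 ≤ levCubeY i c z → z ∈ T ∧ ∀ μ, shiftY i μ z ∈ T ∧ (shiftY i μ).symm z ∈ T ∧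
      ∀ ν, shiftY i ν (shiftY i μ z) ∈ T ∧ shiftY i ν ((shiftY i μ).symm z) ∈ T ∧ (shiftY i ν).symm ((shiftY i μ).symm z) ∈ T := fun z hz => by
    obtain ⟨h0, hμ⟩ := hS2 z hz
    exact ⟨hTS _ h0, fun μ => ⟨hTS _ (hμ μ).1, hTS _ (hμ μ).2.1, fun ν =>
      ⟨hTS _ ((hμ μ).2.2 ν).1, hTS _ ((hμ μ).2.2 ν).2.1, hTS _ ((hμ μ).2.2 ν).2.2⟩⟩⟩
  -- the two fields agree on the bonds inside `Ω₀(□)`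
  have hin : ∀ z ∈ S, ∀ μ : Fin (d + 1), shiftY i μ z ∈ S → UboxY i V μ z = UboxY i (cutCfgS i S η A) μ z := fun z hz μ hz' => by
    rw [hVdef, UboxY_cutCfgS, UboxY_cutCfgS, if_pos ⟨hTS z hz, hTS _ hz'⟩, if_pos ⟨hz, hz'⟩]
  -- F1: `hT1` and the `U = 1` rows at the rate `δ`
  have hT1' := TKnitCY_one_eq_liftOpY_mDirC (N := N) i c
  obtain ⟨gG, gDG, gLG⟩ := h33 i c Rr H KB hKB hMG'
  have hG : HasMajorant (g := toB6 (geoCK i c) Rr H) (blkBK i c) (GiK b i (TKnitCY i c (fun _ _ => 1)) B)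
      (fun a a' => AG * (geoCK i c).len a ^ 2 * Real.exp (-(δ * (geoCK i c).dist a a'))) :=
    hasMajorant_mono (g := toB6 (geoCK i c) Rr H) _ gG fun a a' => kernel_rate_mono hdnn hδG' (mul_nonneg hAG.le (sq_nonneg _)) a a'
  have hDG : ∀ ν, HasMajorant (g := toB6 (geoCK i c) Rr H) (blkBK i c) (DK b i ν * GiK b i (TKnitCY i c (fun _ _ => 1)) B)
      (fun a a' => AG * (geoCK i c).len a * Real.exp (-(δ * (geoCK i c).dist a a'))) := fun ν =>
    hasMajorant_mono (g := toB6 (geoCK i c) Rr H) _ (gDG ν) fun a a' => kernel_rate_mono hdnn hδG' (mul_nonneg hAG.le (geoCK_len_pos i c a).le) a a'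
  have hδ₀δ : δ₀ ≤ δ := by rw [hδ₀def]; linarith
  have hGρ : HasMajorant (g := toB6 (geoCK i c) Rr H) (blkBK i c) (GiK b i (TKnitCY i c (fun _ _ => 1)) B)
      (fun a a' => AG * (geoCK i c).len a ^ 2 * Real.exp (-(δ₀ * (geoCK i c).dist a a'))) :=
    hasMajorant_mono (g := toB6 (geoCK i c) Rr H) _ hG fun a a' => kernel_rate_mono hdnn hδ₀δ (mul_nonneg hAG.le (sq_nonneg _)) a a'
  have hDGρ : ∀ ν, HasMajorant (g := toB6 (geoCK i c) Rr H) (blkBK i c) (DK b i ν * GiK b i (TKnitCY i c (fun _ _ => 1)) B)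
      (fun a a' => AG * (geoCK i c).len a * Real.exp (-(δ₀ * (geoCK i c).dist a a'))) := fun ν =>
    hasMajorant_mono (g := toB6 (geoCK i c) Rr H) _ (hDG ν) fun a a' => kernel_rate_mono hdnn hδ₀δ (mul_nonneg hAG.le (geoCK_len_pos i c a).le) a a'
  have hLGρ : HasMajorant (g := toB6 (geoCK i c) Rr H) (blkBK i c) (LapK b i * GiK b i (TKnitCY i c (fun _ _ => 1)) B)
      (fun a a' => AG * Real.exp (-(δ₀ * (geoCK i c).dist a a'))) :=
    hasMajorant_mono (g := toB6 (geoCK i c) Rr H) _ gLG fun a a' => kernel_rate_mono hdnn (hδ₀δ.trans hδG') hAG.le a a'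
  -- F3: the windows of the sharp cut (constant `αW = alphaW(α₁)·L²`)
  have hW1 := hW1_cut i c hC hξ hΛ hΛξ hQT hA hdA hS2T hRM
  have hW2 := hW2_cut i c hC hξ hΛ hΛξ hQT hA hdA hS2T hRM
  have hW3 := hW3_cut i c hC hξ hΛ hΛξ hQT hA hdA hS2T hRM hU
  have hW3' : ∀ (a : BlkCubeY i c) (p : Node00.PlaqY i), dSite i c a p.src ≤ 2 →
      ‖Node00.reHolY i V p - 1‖ ≤ αW * ((kGeo i).eta * ((geoCK i c).len a)⁻¹) ^ 2 := fun a p hp => (hW3 a p hp).1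
  -- SLOT hW0 ∕ hW1: (3.73) + (3.75) first-order pieces at the windows
  have hLap : lapPieceK b i V = conj b ((V0Y i V).restrictScalars ℝ) + ∑ μ, conj b ((V1Y i V μ).restrictScalars ℝ) * DK b i μ :=
    conj_hessY_one_sub_hessY_eq i b _
  have hV0 := hasMajorant_V0Y i c b hU hM₂ hrepr hαW0 hαW1 hW1 hW2 hW3 hδ.le Rr H
  have hV1 := fun ν => hasMajorant_V1Y i c b hU hM₂ hrepr hαW0 hW1 hW3' hδ.le Rr H ν
  have hP0 := hasMajorant_P0Y i c b hU hM₂ hrepr hαW0 hαW1 hW1 hW2 hδ.le Rr H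
  have hP1 := fun ν => hasMajorant_P1Y i c b hU hM₂ hrepr hαW0 hW1 hδ.le Rr H ν
  have hW0' : HasMajorant (g := toB6 (geoCK i c) Rr H) (blkBK i c) (conj b ((V0Y i V).restrictScalars ℝ) + conj b ((P0Y i V).restrictScalars ℝ))
      (fun a a' => (cV + cP) * αW * ((geoCK i c).len a ^ 2)⁻¹ * Real.exp (-(δ * (geoCK i c).dist a a'))) := by
    refine hasMajorant_mono (g := toB6 (geoCK i c) Rr H) _ (hasMajorant_add (g := toB6 (geoCK i c) Rr H) _ hV0 hP0) fun a a' => ?_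
    have hw : 0 ≤ αW * ((geoCK i c).len a ^ 2)⁻¹ * Real.exp (-(δ * (geoCK i c).dist a a')) := by positivity
    have hleV : (M₂ * ∑ j, ‖b j‖) * (cV0 d * Real.exp (2 * δ)) ≤ cV := by
      rw [hcVdef, mul_assoc (M₂ * ∑ j, ‖b j‖)]; exact mul_le_mul_of_nonneg_left (mul_le_mul_of_nonneg_right (le_max_left _ _) (Real.exp_pos _).le) hMS
    have hleP : (M₂ * ∑ j, ‖b j‖) * (cP0 d * Real.exp (2 * δ)) ≤ cP := by
      rw [hcPdef, mul_assoc (M₂ * ∑ j, ‖b j‖)]; exact mul_le_mul_of_nonneg_left (mul_le_mul_of_nonneg_right (le_max_left _ _) (Real.exp_pos _).le) hMS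
    calc (M₂ * ∑ j, ‖b j‖) * (cV0 d * Real.exp (2 * δ) * αW * ((geoCK i c).len a ^ 2)⁻¹ * Real.exp (-(δ * (geoCK i c).dist a a'))) +
          (M₂ * ∑ j, ‖b j‖) * (cP0 d * Real.exp (2 * δ) * αW * ((geoCK i c).len a ^ 2)⁻¹ * Real.exp (-(δ * (geoCK i c).dist a a')))
        = ((M₂ * ∑ j, ‖b j‖) * (cV0 d * Real.exp (2 * δ)) + (M₂ * ∑ j, ‖b j‖) * (cP0 d * Real.exp (2 * δ))) *
            (αW * ((geoCK i c).len a ^ 2)⁻¹ * Real.exp (-(δ * (geoCK i c).dist a a'))) := by ring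
      _ ≤ (cV + cP) * (αW * ((geoCK i c).len a ^ 2)⁻¹ * Real.exp (-(δ * (geoCK i c).dist a a'))) := mul_le_mul_of_nonneg_right (add_le_add hleV hleP) hw
      _ = (cV + cP) * αW * ((geoCK i c).len a ^ 2)⁻¹ * Real.exp (-(δ * (geoCK i c).dist a a')) := by ring
  have hW1' : ∀ ν, HasMajorant (g := toB6 (geoCK i c) Rr H) (blkBK i c) (conj b ((V1Y i V ν).restrictScalars ℝ) + conj b ((P1Y i V ν).restrictScalars ℝ))
      (fun a a' => (cV + cP) * αW * ((geoCK i c).len a)⁻¹ * Real.exp (-(δ * (geoCK i c).dist a a'))) := fun ν => by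
    refine hasMajorant_mono (g := toB6 (geoCK i c) Rr H) _ (hasMajorant_add (g := toB6 (geoCK i c) Rr H) _ (hV1 ν) (hP1 ν)) fun a a' => ?_
    have hl : 0 ≤ ((geoCK i c).len a)⁻¹ := inv_nonneg.2 (geoCK_len_pos i c a).le
    have hw : 0 ≤ αW * ((geoCK i c).len a)⁻¹ * Real.exp (-(δ * (geoCK i c).dist a a')) := by positivity
    have hleV : (M₂ * ∑ j, ‖b j‖) * (cV1 d * Real.exp (2 * δ)) ≤ cV := by
      rw [hcVdef, mul_assoc (M₂ * ∑ j, ‖b j‖)]; exact mul_le_mul_of_nonneg_left (mul_le_mul_of_nonneg_right (le_max_right _ _) (Real.exp_pos _).le) hMS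
    have hleP : (M₂ * ∑ j, ‖b j‖) * (cP1 d * Real.exp (2 * δ)) ≤ cP := by
      rw [hcPdef, mul_assoc (M₂ * ∑ j, ‖b j‖)]; exact mul_le_mul_of_nonneg_left (mul_le_mul_of_nonneg_right (le_max_right _ _) (Real.exp_pos _).le) hMS
    calc (M₂ * ∑ j, ‖b j‖) * (cV1 d * Real.exp (2 * δ) * αW * ((geoCK i c).len a)⁻¹ * Real.exp (-(δ * (geoCK i c).dist a a'))) +
          (M₂ * ∑ j, ‖b j‖) * (cP1 d * Real.exp (2 * δ) * αW * ((geoCK i c).len a)⁻¹ * Real.exp (-(δ * (geoCK i c).dist a a')))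
        = ((M₂ * ∑ j, ‖b j‖) * (cV1 d * Real.exp (2 * δ)) + (M₂ * ∑ j, ‖b j‖) * (cP1 d * Real.exp (2 * δ))) *
            (αW * ((geoCK i c).len a)⁻¹ * Real.exp (-(δ * (geoCK i c).dist a a'))) := by ring
      _ ≤ (cV + cP) * (αW * ((geoCK i c).len a)⁻¹ * Real.exp (-(δ * (geoCK i c).dist a a'))) := mul_le_mul_of_nonneg_right (add_le_add hleV hleP) hw
      _ = (cV + cP) * αW * ((geoCK i c).len a)⁻¹ * Real.exp (-(δ * (geoCK i c).dist a a')) := by ring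
  -- SLOT hPP: ROAD (I)'s (3.77) at the field cut AT `Ω₀`, compressed (F2a) — the same compression as at `V` (F2b)
  obtain ⟨-, hPPS⟩ := HCP i c Rr H hMP hNP hTP A Q C ξ Λ α₀' hC hξ hΛ hΛξ hQS hA hdA hS2 hα₁P hα' hα3 hα4' hsmall hc₃ hsm
  have hPP : HasMajorant (g := toB6 (geoCK i c) Rr H) (blkBK i c)
      (projK b i B * conj b ((gradY i (cutCfgS i S η A) ∘ₗ PDirCubeY i c S (cutCfgS i S η A) ∘ₗ divY i (cutCfgS i S η A) -
        gradY i (fun _ _ => 1) ∘ₗ PDirCubeY i c S (fun _ _ => 1) ∘ₗ divY i (fun _ _ => 1)).restrictScalars ℝ) * projK b i B)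
      (fun a a' => K * αW * ((geoCK i c).len a ^ 2)⁻¹ * Real.exp (-(δ * (geoCK i c).dist a a'))) := by
    refine hasMajorant_mono (g := toB6 (geoCK i c) Rr H) _ (hasMajorant_projK_mul_mul_projK b i c B Rr H hPPS) fun a a' => ?_
    calc K * (2 * C * Λ ^ 2) * ((geoCK i c).len a ^ 2)⁻¹ * Real.exp (-(δP * (geoCK i c).dist a a'))
        = (K * α₁) * ((geoCK i c).len a ^ 2)⁻¹ * Real.exp (-(δP * (geoCK i c).dist a a')) := by rw [hα₁def]
      _ ≤ (K * αW) * ((geoCK i c).len a ^ 2)⁻¹ * Real.exp (-(δ * (geoCK i c).dist a a')) :=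
          kernel_const_mono hdnn (fun a => ((geoCK i c).len a ^ 2)⁻¹) (fun a => by positivity) (mul_le_mul_of_nonneg_left hαWα hK)
            (mul_nonneg hK hαW0) hδP' a a'
      _ = K * αW * ((geoCK i c).len a ^ 2)⁻¹ * Real.exp (-(δ * (geoCK i c).dist a a')) := by ring
  -- SLOT hAv: dag-n06-j's knit averaging piece at `a := Ã`
  have hVfl : ∀ μ x, V μ x = fluct (kGeo i).eta (cutFldS i T A) μ x := fun μ x => by
    rw [hVdef]; show fluct (kGeo i).eta (cutFldS i T A) μ x * 1 = _; rw [mul_one]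
  have hAv0 := hasMajorant_avgPieceCKnit b i c hα₀ hMα hα' hα3 hα8 hKpl hϱ' hϱ hsmall' hc₃' hϱ'1 hE hdX hsmallJ hc₃J hM₂ hrepr hb₀ hb₁ (cutFldS i T A) hα₁0
    hα₁ϱ (ha_cut i c hC hΛ hΛξ hQT hA) V hVfl hδ.le Rr H
  have hAv : HasMajorant (g := toB6 (geoCK i c) Rr H) (blkBK i c) (avgPieceCKnit b i c V)
      (fun a a' => κ₂ * αW * ((geoCK i c).len a ^ 2)⁻¹ * Real.exp (-(δ * (geoCK i c).dist a a'))) := by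
    refine hasMajorant_mono (g := toB6 (geoCK i c) Rr H) _ hAv0 fun a a' => ?_
    have hw : 0 ≤ ((geoCK i c).len a ^ 2)⁻¹ * Real.exp (-(δ * (geoCK i c).dist a a')) := by positivity
    have hk : (M₂ * ∑ j, ‖b j‖) * kappaAvKnit d ℓ N b₁ ϱ' α₁ δ * α₁ ≤ κ₂ * αW := by
      rw [hκ₂def]
      exact mul_le_mul (mul_le_mul_of_nonneg_left (kappaAvKnit_mono hb₁0 hϱ' hα₁1) hMS) hαWα hα₁0
        (mul_nonneg hMS (kappaAvKnit_nonneg hb₁0 hϱ' zero_le_one))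
    calc (M₂ * ∑ j, ‖b j‖) * kappaAvKnit d ℓ N b₁ ϱ' α₁ δ * α₁ * ((geoCK i c).len a ^ 2)⁻¹ * Real.exp (-(δ * (geoCK i c).dist a a'))
        = ((M₂ * ∑ j, ‖b j‖) * kappaAvKnit d ℓ N b₁ ϱ' α₁ δ * α₁) * (((geoCK i c).len a ^ 2)⁻¹ * Real.exp (-(δ * (geoCK i c).dist a a'))) := by ring
      _ ≤ (κ₂ * αW) * (((geoCK i c).len a ^ 2)⁻¹ * Real.exp (-(δ * (geoCK i c).dist a a'))) := mul_le_mul_of_nonneg_right hk hw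
      _ = κ₂ * αW * ((geoCK i c).len a ^ 2)⁻¹ * Real.exp (-(δ * (geoCK i c).dist a a')) := by ring
  -- the (3.84) split at the knit pair, regrouped, and COMPRESSED with the `Ω₀`-cut projection word (F2b)
  have hX : conj b ((TKnitCY i c (fun _ _ => 1) - TKnitCY i c V).restrictScalars ℝ) =
      lapPieceK b i V + projPieceDirK b i c S V + avgPieceCKnit b i c V := by
    rw [TKnitCY_apply, TKnitCY_apply]; exact dirB_split_CK b i c S V
  have hProj := projPieceDirK_eq_firstOrder_add_projWord b i c S V
  have hsplit : conj b ((TKnitCY i c (fun _ _ => 1) - TKnitCY i c V).restrictScalars ℝ) =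
      (conj b ((V0Y i V).restrictScalars ℝ) + conj b ((P0Y i V).restrictScalars ℝ)) +
        ∑ ν, (conj b ((V1Y i V ν).restrictScalars ℝ) + conj b ((P1Y i V ν).restrictScalars ℝ)) * DK b i ν +
        conj b ((gradY i V ∘ₗ PDirCubeY i c S V ∘ₗ divY i V - gradY i (fun _ _ => 1) ∘ₗ PDirCubeY i c S (fun _ _ => 1) ∘ₗ divY i (fun _ _ => 1)).restrictScalars ℝ) +
        avgPieceCKnit b i c V := by
    rw [hX, hLap, hProj]
    simp only [add_mul, Finset.sum_add_distrib]
    abel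
  have hcongr := projK_projWordDir_projK_congr_of_inside i c S hin hS1 b
  have hsplitC := splitC_of_split_of_congr b i (B := B) hsplit hcongr
  -- (2.61) twice (same exponent, `ρ = δ₀`), the two scale transfers
  have h261' : Ineq261 dB (toB6 (geoCK i c) Rr H) δ₀ (9 / 5000) := h261 i c Rr H hN1 (9 / 5000) le_rfl (by norm_num)
  obtain ⟨hST1, hST2, -⟩ := hST_geoCK i c hδ₀ hT1 (9 / 5000) le_rfl
  -- F2a: the `G`-step and the rows
  obtain ⟨hunit, hlaws, htr⟩ := cor35_GDir_of_piecesC b i c (T := TKnitCY i c) hT1' hKB Rr H dB dB δ₀ δ (9 / 5000) (9 / 5000) δ₀ (9 / 5000)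
    (((ℓ : ℝ) + 1) ^ 4) AG (cV + cP) K κ₂ αW hAG.le (add_nonneg hcV hcP) hK hκ₂ hαW0 (by positivity) hδ₀.le (by norm_num) (by norm_num) hδ₀.le
    (by rw [hδ₀def]; nlinarith) (by norm_num) (by positivity) h261' h261' hST1 hST2 hsmallκ V hG hDG hsplitC hW0' hW1' hPP hAv
  obtain ⟨r0, r1, r3⟩ := cor35_GDir_rows_of_piecesC b i c (T := TKnitCY i c) hT1' hKB Rr H dB dB δ₀ δ (9 / 5000) (9 / 5000) δ₀ (9 / 5000)
    (((ℓ : ℝ) + 1) ^ 4) AG (cV + cP) K κ₂ αW hAG.le (add_nonneg hcV hcP) hK hκ₂ hαW0 (by positivity) hδ₀.le (by norm_num) (by norm_num) hδ₀.le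
    (by rw [hδ₀def]; nlinarith) (by norm_num) (by positivity) h261' h261' hST1 hST2 hsmallκ V hG hDG hsplitC hW0' hW1' hPP hAv hAG.le hGρ hDGρ hLGρ
  -- the transfer clause with the constant `θ = 2c₁`
  have htr' : ∀ (X : Module.End ℝ (FBondY i × ι → ℝ)) (B₀' : ℝ) (P : BlkCubeY i c → ℝ), 0 ≤ B₀' → (∀ y, 0 ≤ P y) →
      HasMajorant (g := toB6 (geoCK i c) Rr H) (blkBK i c) (X * GiK b i (TKnitCY i c (fun _ _ => 1)) B)
        (fun a a' => B₀' * P a * Real.exp (-(δ₀ * (geoCK i c).dist a a'))) →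
      HasMajorant (g := toB6 (geoCK i c) Rr H) (blkBK i c) (X * GiK b i (TKnitCY i c V) B)
        (fun a a' => B₀' * (2 * B6.c1 dB δ₀ (9 / 5000)) * P a * Real.exp (-((1 - 9 / 5000) * δ₀ * (geoCK i c).dist a a'))) := by
    intro X B₀' P hB₀' hP hXG
    refine hasMajorant_mono (g := toB6 (geoCK i c) Rr H) _ (htr X B₀' P hB₀' hP hXG) fun a a' => ?_
    have hw : 0 ≤ P a * Real.exp (-((1 - 9 / 5000) * δ₀ * (geoCK i c).dist a a')) := mul_nonneg (hP a) (Real.exp_pos _).le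
    calc B₀' * B6.c1 dB δ₀ (9 / 5000) *
          (1 - kappa385d AG (cV + cP) K κ₂ (((ℓ : ℝ) + 1) ^ 4) (B6.c1 dB δ₀ (9 / 5000)) (d + 1) * αW * B6.c1 dB δ₀ (9 / 5000))⁻¹ * P a *
          Real.exp (-((1 - 9 / 5000) * δ₀ * (geoCK i c).dist a a'))
        = B₀' * (B6.c1 dB δ₀ (9 / 5000) *
            (1 - kappa385d AG (cV + cP) K κ₂ (((ℓ : ℝ) + 1) ^ 4) (B6.c1 dB δ₀ (9 / 5000)) (d + 1) * αW * B6.c1 dB δ₀ (9 / 5000))⁻¹) *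
            (P a * Real.exp (-((1 - 9 / 5000) * δ₀ * (geoCK i c).dist a a'))) := by ring
      _ ≤ B₀' * (B6.c1 dB δ₀ (9 / 5000) * 2) * (P a * Real.exp (-((1 - 9 / 5000) * δ₀ * (geoCK i c).dist a a'))) := by gcongr
      _ = B₀' * (2 * B6.c1 dB δ₀ (9 / 5000)) * P a * Real.exp (-((1 - 9 / 5000) * δ₀ * (geoCK i c).dist a a')) := by ring
  -- the three transferred left entries
  have hlen0 : ∀ y : BlkCubeY i c, 0 ≤ (geoCK i c).len y := fun y => (geoCK_len_pos i c y).le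
  have t0 := htr' 1 AG (fun a => (geoCK i c).len a ^ 2) hAG.le (fun _ => sq_nonneg _) (by rw [one_mul]; exact hGρ)
  rw [one_mul] at t0
  have t1 := fun ν => htr' (DK b i ν) AG (fun a => (geoCK i c).len a) hAG.le hlen0 (hDGρ ν)
  have t3 := htr' (LapK b i) AG (fun _ => (1 : ℝ)) hAG.le (fun _ => zero_le_one) (by
    refine hasMajorant_mono (g := toB6 (geoCK i c) Rr H) _ hLGρ fun a a' => le_of_eq ?_
    rw [mul_one])
  refine ⟨?_, hlaws, htr', ⟨hGρ, hDGρ, hLGρ⟩, ⟨t0, t1, t3⟩⟩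
  rw [← dirPadY_TKnitCY]; exact hunit

set_option maxHeartbeats 1000000 in
/-- ★★★ **COROLLARY 3.6 FOR THE DIRICHLET BOND LETTER OF RECORD `G_□ = (Ω₀(Δ_{loc,□}[Q^knit_□] − D𝒫_□D*)Ω₀)⁻¹` AT THE SHARP-CUT FIELD `Ṽ = cutCfgS i T η A`, UNIFORMLY IN THE
MEMBER AND THE COVER CUBE — CONDITIONAL BY NAME ON [4] PROP. 2.6 FOR `G(Ω)`** (see the module doc for the slot list): under `h26` and the x-free numerics, there are
`ρ > 0`, `θ ≥ 0`, thresholds `M₀, T₀, N₀`, `a₁ > 0` and `A_G > 0` such that for every member above the thresholds, every `□`, `Rr`, `H`, bond socket `K_B`, cut set `T ⊇ Ω₀(□)`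
and datum `(A; Q ⊇ chart⁻¹T, C, ξ, Λ)` with the displayed numerics and a bi-contractive `Ṽ`: (i) `padΔ_{loc,□}(Ṽ)` is a unit; (ii) the two padded (3.86) laws and the
compressed one for `GiK b i (TKnitCY i □ Ṽ) B = conj b(G_□(Ṽ)♯ℝ)`; (iii) the left-entry transfer at rate `ρ`; (iv) Theorem 3.3's flat `U = 1` entries at rate `ρ`;
(v) their transfers `GiK(Ṽ) ≺ A_Gθ(Lⁿη)²e^{−(1−9∕5000)ρd}`, `∇_ν·GiK(Ṽ) ≺ A_GθLⁿηe^{−(1−9∕5000)ρd}`, `Δ·GiK(Ṽ) ≺ A_Gθ·1·e^{−(1−9∕5000)ρd}`.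
[cite: Balaban1985BackgroundPropagators, Cor. 3.6 p.408, Cor. 3.5 p.407, Thm 3.4 p.400, (3.82)–(3.86) p.407, (3.69)–(3.77) pp.404–406, (3.83) p.407, Thm 3.3 p.399, (3.42) p.397, p.409 l.1–5; Balaban1984PropagatorsII, Lemma 2.1 (2.61) p.234, (2.51) p.232, (2.66) p.234, Prop. 2.6 (2.136) p.247, p.248 l.4–5] -/
theorem gDir_knit_at_cutField
    (h26 : B6.Prop26DirichletPrinted (geoDirBI (d := d) (ℓ := ℓ) (hd := hd) (hL := hL) (b₀ := b₀) (b₁ := b₁)) domDirBI admDirBI GDirBFam)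
    (hℓ : 1 ≤ ℓ) (hb₀ : 0 < b₀) (hb₁ : b₀ ≤ b₁) (M₂ : ℝ) (hM₂ : 0 ≤ M₂) (hrepr : ∀ (v : Matrix (Fin N) (Fin N) ℂ) (j : ι), |b.repr v j| ≤ M₂ * ‖v‖)
    -- the x-free numerics of dag-n06-j's knit engine (head rows)
    {α₀ α₀' ϱ' ϱ : ℝ} (hα₀ : 0 < α₀) (hα' : 0 < α₀') (hα3 : C0 (d + 1) * α₀' ≤ 1 / 3) (hα8 : 8 * α₀' ≤ c2' (d + 1) (ℓ + 1))
    (hϱ' : 0 < ϱ') (hϱ : 0 < ϱ)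
    (hsmall' : Real.exp (4 * (800 * (((d + 1 : ℕ) : ℝ) + 1) ^ 2 * (((d + 1 : ℕ) : ℝ) + 4)) * α₀') * (1 + 8 * (131072 * (((d + 1 : ℕ) : ℝ) + 1) ^ 2) * ϱ') ≤ 2)
    (hc₃' : 2 * ϱ' ≤ c3 (d + 1) (ℓ + 1)) (hϱ'1 : 409600 * (((d + 1 : ℕ) : ℝ) + 1) ^ 2 * ϱ' ≤ 1)
    (hE : epsCplx (d + 1) (ℓ + 1) ϱ' 0 ≤ 1 / 16)
    (hdX : ((d + 1 : ℕ) : ℝ) * (epsCplx (d + 1) (ℓ + 1) ϱ' 0 + tauCplx (d + 1) (ℓ + 1) α₀' 0 ϱ' 0) ≤ 1 / 16)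
    (hsmallJ : Real.exp (4480 * (((d + 1 : ℕ) : ℝ) + 1) ^ 2 * (((d + 1 : ℕ) : ℝ) + 4) * α₀' + 240000 * (((d + 1 : ℕ) : ℝ) + 1) ^ 3 * ϱ') *
      (1 + 8 * (2097152 * (((d + 1 : ℕ) : ℝ) + 1) ^ 2) * ϱ) ≤ 2)
    (hc₃J : 2 * ϱ ≤ c3 (d + 1) (ℓ + 1) / 4) :
    ∃ ρ θ M₀ T₀ : ℝ, ∃ N₀ : ℕ, 0 < ρ ∧ 0 ≤ θ ∧ ∃ a₁ : ℝ, 0 < a₁ ∧ ∃ AG : ℝ, 0 < AG ∧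
    ∀ (i : KIdx d ℓ hd hL b₀ b₁) (c : ↥(cubes (toKT i).D.toDomains)) (Rr : ℝ) (H : Prop),
      M₀ ≤ ((ℓ : ℝ) + 1) * (toKT i).Mh → N₀ + 1 ≤ (toKT i).R * ((ℓ + 1) * (toKT i).Mh) → T₀ ≤ RM1 i →
      0 ≤ (kGeo i).M * α₀ → Kpl i ((kGeo i).M * α₀) * (kGeo i).L ^ 4 < α₀' →
    ∀ (KB : Matrix (FBondY i) (FBondY i) ℝ),
      (mDirC i c).submatrix (fun v : ↥(bondsOverY i (dirDomY i c)) => (v : FBondY i)) (fun v : ↥(bondsOverY i (dirDomY i c)) => (v : FBondY i)) *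
        KB.submatrix (fun v : ↥(bondsOverY i (dirDomY i c)) => (v : FBondY i)) (fun v : ↥(bondsOverY i (dirDomY i c)) => (v : FBondY i)) = 1 →
    ∀ (T : Finset (SiteY i)) (A : AfldY (Matrix (Fin N) (Fin N) ℂ) i) (Q : Set (Site (PV d ℓ i.m i.K hd hL) 0)) (C ξ Λ : ℝ),
      0 ≤ C → (kGeo i).eta ≤ ξ → 1 ≤ Λ → LatticeNorms.scaleLen ((ℓ : ℝ) + 1) (kGeo i).eta (c.1.1 + 1) ≤ Λ * ξ →
      (∀ z ∈ dirDomY i c, z ∈ T) → (∀ z ∈ T, (boxEquiv i.hN).symm z ∈ Q) →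
      (∀ κ, ∀ x ∈ Q, ‖A κ x‖ ≤ C * ξ⁻¹) →
      (∀ μ ν, ∀ x ∈ Q, ‖(((kGeo i).eta : ℂ)⁻¹) • covD (shiftsV1 (PV d ℓ i.m i.K hd hL)) (fun _ _ => (1 : (Matrix (Fin N) (Fin N) ℂ)ˣ)) μ (A ν) x‖ ≤ C * (ξ ^ 2)⁻¹) →
      (∀ z : SiteY i, 1 ≤ levCubeY i c z → z ∈ dirDomY i c ∧ ∀ μ, shiftY i μ z ∈ dirDomY i c ∧ (shiftY i μ).symm z ∈ dirDomY i c ∧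
        ∀ ν, shiftY i ν (shiftY i μ z) ∈ dirDomY i c ∧ shiftY i ν ((shiftY i μ).symm z) ∈ dirDomY i c ∧ (shiftY i ν).symm ((shiftY i μ).symm z) ∈ dirDomY i c) →
      2 * C * Λ ^ 2 ≤ a₁ → 3 * (2 * C * Λ ^ 2) ≤ ϱ' →
      4 * α₀' ≤ c2' (d + 1) (ℓ + 1) →
      Real.exp (4 * (800 * (((d + 1 : ℕ) : ℝ) + 1) ^ 2 * (((d + 1 : ℕ) : ℝ) + 4)) * α₀') * (1 + 8 * (131072 * (((d + 1 : ℕ) : ℝ) + 1) ^ 2) * (2 * C * Λ ^ 2)) ≤ 2 →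
      2 * (2 * C * Λ ^ 2) ≤ c3 (d + 1) (ℓ + 1) → 4096 * ((d + 1 : ℕ) : ℝ) * (2 * C * Λ ^ 2) ≤ 1 →
      (∀ μ x, ‖(cutCfgS i T (kGeo i).eta A μ x : Matrix (Fin N) (Fin N) ℂ)‖ ≤ 1 ∧
        ‖(((cutCfgS i T (kGeo i).eta A μ x)⁻¹ : (Matrix (Fin N) (Fin N) ℂ)ˣ) : Matrix (Fin N) (Fin N) ℂ)‖ ≤ 1) →
      IsUnit (padDeltaLocCY i c (QknitCubeY i c) (QsknitCubeY i c) (DPDsDirCubeY i c (dirDomY i c)) (bondsOverY i (dirDomY i c)) (cutCfgS i T (kGeo i).eta A)) ∧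
      (GdK b i (TKnitCY i c (cutCfgS i T (kGeo i).eta A)) (bondsOverY i (dirDomY i c)) =
          GdK b i (TKnitCY i c (fun _ _ => 1)) (bondsOverY i (dirDomY i c)) +
            GdK b i (TKnitCY i c (fun _ _ => 1)) (bondsOverY i (dirDomY i c)) * VdK b i (TKnitCY i c) (bondsOverY i (dirDomY i c)) (cutCfgS i T (kGeo i).eta A) *
              GdK b i (TKnitCY i c (cutCfgS i T (kGeo i).eta A)) (bondsOverY i (dirDomY i c)) ∧
        GdK b i (TKnitCY i c (cutCfgS i T (kGeo i).eta A)) (bondsOverY i (dirDomY i c)) =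
          GdK b i (TKnitCY i c (fun _ _ => 1)) (bondsOverY i (dirDomY i c)) +
            GdK b i (TKnitCY i c (cutCfgS i T (kGeo i).eta A)) (bondsOverY i (dirDomY i c)) *
              (VdK b i (TKnitCY i c) (bondsOverY i (dirDomY i c)) (cutCfgS i T (kGeo i).eta A) * GdK b i (TKnitCY i c (fun _ _ => 1)) (bondsOverY i (dirDomY i c))) ∧
        GiK b i (TKnitCY i c (cutCfgS i T (kGeo i).eta A)) (bondsOverY i (dirDomY i c)) =
          GiK b i (TKnitCY i c (fun _ _ => 1)) (bondsOverY i (dirDomY i c)) +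
            GiK b i (TKnitCY i c (cutCfgS i T (kGeo i).eta A)) (bondsOverY i (dirDomY i c)) *
              (VdK b i (TKnitCY i c) (bondsOverY i (dirDomY i c)) (cutCfgS i T (kGeo i).eta A) * GiK b i (TKnitCY i c (fun _ _ => 1)) (bondsOverY i (dirDomY i c)))) ∧
      (∀ (X : Module.End ℝ (FBondY i × ι → ℝ)) (B₀' : ℝ) (P : BlkCubeY i c → ℝ), 0 ≤ B₀' → (∀ y, 0 ≤ P y) →
        HasMajorant (g := toB6 (geoCK i c) Rr H) (blkBK i c) (X * GiK b i (TKnitCY i c (fun _ _ => 1)) (bondsOverY i (dirDomY i c)))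
          (fun a a' => B₀' * P a * Real.exp (-(ρ * (geoCK i c).dist a a'))) →
        HasMajorant (g := toB6 (geoCK i c) Rr H) (blkBK i c) (X * GiK b i (TKnitCY i c (cutCfgS i T (kGeo i).eta A)) (bondsOverY i (dirDomY i c)))
          (fun a a' => B₀' * θ * P a * Real.exp (-((1 - 9 / 5000) * ρ * (geoCK i c).dist a a')))) ∧
      (HasMajorant (g := toB6 (geoCK i c) Rr H) (blkBK i c) (GiK b i (TKnitCY i c (fun _ _ => 1)) (bondsOverY i (dirDomY i c)))
          (fun a a' => AG * (geoCK i c).len a ^ 2 * Real.exp (-(ρ * (geoCK i c).dist a a'))) ∧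
        (∀ ν : Fin (d + 1), HasMajorant (g := toB6 (geoCK i c) Rr H) (blkBK i c) (DK b i ν * GiK b i (TKnitCY i c (fun _ _ => 1)) (bondsOverY i (dirDomY i c)))
          (fun a a' => AG * (geoCK i c).len a * Real.exp (-(ρ * (geoCK i c).dist a a')))) ∧
        HasMajorant (g := toB6 (geoCK i c) Rr H) (blkBK i c) (LapK b i * GiK b i (TKnitCY i c (fun _ _ => 1)) (bondsOverY i (dirDomY i c)))
          (fun a a' => AG * Real.exp (-(ρ * (geoCK i c).dist a a')))) ∧
      (HasMajorant (g := toB6 (geoCK i c) Rr H) (blkBK i c) (GiK b i (TKnitCY i c (cutCfgS i T (kGeo i).eta A)) (bondsOverY i (dirDomY i c)))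
          (fun a a' => AG * θ * (geoCK i c).len a ^ 2 * Real.exp (-((1 - 9 / 5000) * ρ * (geoCK i c).dist a a'))) ∧
        (∀ ν : Fin (d + 1), HasMajorant (g := toB6 (geoCK i c) Rr H) (blkBK i c) (DK b i ν * GiK b i (TKnitCY i c (cutCfgS i T (kGeo i).eta A)) (bondsOverY i (dirDomY i c)))
          (fun a a' => AG * θ * (geoCK i c).len a * Real.exp (-((1 - 9 / 5000) * ρ * (geoCK i c).dist a a')))) ∧
        HasMajorant (g := toB6 (geoCK i c) Rr H) (blkBK i c) (LapK b i * GiK b i (TKnitCY i c (cutCfgS i T (kGeo i).eta A)) (bondsOverY i (dirDomY i c)))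
          (fun a a' => AG * θ * 1 * Real.exp (-((1 - 9 / 5000) * ρ * (geoCK i c).dist a a')))) := by
  obtain ⟨ρ, θ, M₀, T₀, N₀, hρ, hθ, a₁, ha₁, AG, hAG, h⟩ := gDir_knit_at_cutFieldU b h26 hℓ hb₀ hb₁ M₂ hM₂ hrepr hα' hα3 hα8 hϱ' hϱ hsmall' hc₃' hϱ'1 hE hdX
    hsmallJ hc₃J
  exact ⟨ρ, θ, M₀, T₀, N₀, hρ, hθ, a₁, ha₁, AG, hAG, fun i c Rr H hM hN hT hMα hKpl => h i c Rr H hM hN hT α₀ hα₀ hMα hKpl⟩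

end Main

end Literature.MathematicalPhysics.QuantumFieldTheory.Balaban1983to89.B9Cor36GDirKnitAtCutField

end
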